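import Literature.NumberTheory.Automorphic.ArchDiagonalTorus     -- ★ D1′b (p06): `circleDiagonal`, `coe_circleDiagonal`, `circleDiagonal_mem_archLocal_diagonal`; ★ `archLocal`, `mem_archLocal_iff`
import HarnessLib

/-!
# The centraliser of a REGULAR point of the diagonal circle torus in `U(σ_w diag α)(ℂ)` is the torus (road D1′ ∕ «D2′a», the algebraic half of (V2))
# (Rogawski 1990, §3.1 p. 19, §8.2 p. 122; Bröcker–tom Dieck IV (3.1))

Topic `NumberTheory/Automorphic`; namespaces `Literature.LinearAlgebra.Matrix` (§1, generic matrices) and `Literature.NumberTheory.Automorphic.UnitaryGroup` (§§2–3).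
THEOREMS ONLY (no definition, no named fact, no instance, no notation, no `sorry`).  Cell `hodgecm-mathlib`, floor-1 prep under #88 (ST-∞) ∕ #111 (S-d): road letter
«D2′a» (LEAD T6-84; CENSUS-D2prime-HClimit §4 (V2)): Harish-Chandra's torus-normalised orbital integrals along the compact Cartan `T_w` of `G_w = U(σ_w diag α)(ℂ∕ℝ)`
(★ `archLocal L N (diagonal α) w`, torus = range of ★ `circleDiagonal N`, D1′b) need ONE Haar measure `t_T` on `T_w` transported to every centraliser `Z_{G_w}(γ)`,
`γ ∈ T_reg` — which presupposes **`Z_{G_w}(γ) = T_w` for regular torus points `γ`**.  This file proves exactly that, at every complex place `w`, for every `N` and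
every non-degenerate diagonal hermitian `α` (no signature hypothesis: compact `U(N)` and `U(p,q)` alike), regularity of `γ = diag(z)` being read as `z` INJECTIVE
(= ★ D1′b `isRegularElt_archDiagTorus_iff` ∕ D1′a `archWeylDiscr_ne_zero_iff`).

* §1 `Literature.LinearAlgebra.Matrix.eq_diagonal_of_diagonal_mul_eq_mul_diagonal` — over any commutative ring: a matrix commuting with `diag(d)`, `d_i − d_j` units for
  `i ≠ j`, is diagonal.
* §2 `UnitaryGroup.exists_eq_circleDiagonal_of_coe_eq_diagonal` — a DIAGONAL element of `U(diag e)(ℂ)` (`e_i ≠ 0`) is a circle-torus point (`|d_i|² e_i = e_i`; the local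
  twin of ★ D1′b `exists_archDiagTorus_eq_of_coe_eq_diagonal`).
* §3 **`UnitaryGroup.mem_centralizer_circleDiagonal_iff`** — for `z` injective and `g ∈ U(σ_w diag α)(ℂ)`: `g` centralises `diag(z)` iff `g` is a torus point;
  **`UnitaryGroup.centralizer_circleDiagonal_eq_subgroupOf`** — `Z_{G_w}(diag z) = T_w` as subgroups of `G_w`; `UnitaryGroup.circleDiagonal_mul_comm` — `T_w` is commutative.

JUNK AUDIT: `hz : Injective z` is necessary (a repeated eigenvalue has a `U(2)`- or `U(1,1)`-block in its centraliser — exactly the singular `γ₀` of the limit formula);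
`hα : ∀ i, α i ≠ 0` is necessary for §2∕§3 (for a degenerate form the diagonal unitary elements need not have circle entries).  `N = 0, 1`: statements true and trivial.
HONEST LABEL: HC_CM is proved only modulo the printed citations until rung 0 closes; this file is linear algebra (count-neutral floor-1 preparation); the measure half of
(V2) — transporting `t_T` along these equalities into ★ `OrbitalMeasureFamily.IsQuotientOf` — is the next brick.

## References
* J. D. Rogawski, *Automorphic Representations of Unitary Groups in Three Variables*, Ann. of Math. Stud. 123 (1990), §3.1 p. 19 (regular elements), §8.2 p. 122 (the compact
  Cartan `γ(θ, φ, ψ)` and its singular points) [Rogawski1990].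
* Th. Bröcker, T. tom Dieck, *Representations of Compact Lie Groups*, GTM 98 (1985), Ch. IV (3.1) (the diagonal maximal torus of `U(n)` and its regular elements) [BrockerTomDieck1985].
-/

set_option autoImplicit false

noncomputable section

open NumberField NumberField.InfinitePlace
open scoped Matrix MatrixGroups ComplexConjugate

/-! ## §1 Matrices commuting with a regular diagonal matrix are diagonal -/

namespace Literature.LinearAlgebra.Matrix

variable {R : Type*} [CommRing R] {n : Type*} [Fintype n] [DecidableEq n]

/-- Off-diagonal entries of a matrix commuting with `diag(d)` vanish where `d_i − d_j` is a unit: from `diag(d)·A = A·diag(d)`, `(d_i − d_j)·A_{ij} = 0`.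
[cite: BrockerTomDieck1985, Ch. IV (3.1)] -/
theorem apply_eq_zero_of_diagonal_mul_eq_mul_diagonal {d : n → R} {A : Matrix n n R} (h : Matrix.diagonal d * A = A * Matrix.diagonal d)
    {i j : n} (hij : IsUnit (d i - d j)) : A i j = 0 := by
  have hent := congrFun (congrFun h i) j
  rw [Matrix.diagonal_mul, Matrix.mul_diagonal] at hent
  have h0 : (d i - d j) * A i j = 0 := by rw [sub_mul, hent, mul_comm, sub_self]
  exact (hij.mul_right_eq_zero).mp h0

/-- **A matrix commuting with a REGULAR diagonal matrix is diagonal**: if `d_i − d_j` is a unit for all `i ≠ j` and `diag(d)·A = A·diag(d)` then `A = diag(A_{11}, …, A_{nn})`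
(any commutative ring). [cite: BrockerTomDieck1985, Ch. IV (3.1)] [cite: Rogawski1990, §3.1 p. 19] -/
theorem eq_diagonal_of_diagonal_mul_eq_mul_diagonal {d : n → R} (hd : ∀ i j, i ≠ j → IsUnit (d i - d j)) {A : Matrix n n R}
    (h : Matrix.diagonal d * A = A * Matrix.diagonal d) : A = Matrix.diagonal fun i => A i i := by
  ext i j
  by_cases hij : i = j
  · subst hij
    rw [Matrix.diagonal_apply_eq]
  · rw [Matrix.diagonal_apply_ne _ hij]
    exact apply_eq_zero_of_diagonal_mul_eq_mul_diagonal h (hd i j hij)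

end Literature.LinearAlgebra.Matrix

namespace Literature.NumberTheory.Automorphic

namespace UnitaryGroup

open Literature.LinearAlgebra.Matrix

/-! ## §2 Diagonal elements of `U(diag e)(ℂ)` are circle-torus points -/

section Local

variable (N : ℕ)

/-- **A DIAGONAL element of `U(diag e)(ℂ)` is a point of the circle torus** when the diagonal form is non-degenerate (`e_i ≠ 0`): unitarity `d̄_i e_i d_i = e_i` forces
`|d_i| = 1`, so `g = circleDiagonal N z` with `z_i = d_i` (local form of ★ `exists_archDiagTorus_eq_of_coe_eq_diagonal`). [cite: BrockerTomDieck1985, Ch. IV (3.1)]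
[cite: Rogawski1990, §8.2 p. 122] -/
theorem exists_eq_circleDiagonal_of_coe_eq_diagonal {e : Fin N → ℂ} (he : ∀ i, e i ≠ 0) {g : GL (Fin N) ℂ}
    (hg : g ∈ unitaryGroupOfForm (starRingEnd ℂ) (Matrix.diagonal e)) {d : Fin N → ℂ}
    (hd : (g : Matrix (Fin N) (Fin N) ℂ) = Matrix.diagonal d) : ∃ z : Fin N → Circle, g = circleDiagonal N z := by
  rw [mem_unitaryGroupOfForm_iff, hd, Matrix.diagonal_map (map_zero _), Matrix.diagonal_transpose, Matrix.diagonal_mul_diagonal,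
    Matrix.diagonal_mul_diagonal] at hg
  have hnorm : ∀ i, ‖d i‖ = 1 := fun i => by
    have hi := congrFun (Matrix.diagonal_injective hg) i
    have h1 : starRingEnd ℂ (d i) * d i = 1 := by
      have h2 : (starRingEnd ℂ (d i) * d i) * e i = 1 * e i := by
        rw [one_mul, mul_assoc, mul_comm (d i), ← mul_assoc]; exact hi
      exact mul_right_cancel₀ (he i) h2
    have h3 : ‖d i‖ ^ 2 = 1 := by
      have := congrArg (fun x : ℂ => ‖x‖) h1
      simpa [norm_mul, Complex.norm_conj, sq] using this
    nlinarith [norm_nonneg (d i), h3]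
  refine ⟨fun i => ⟨d i, mem_sphere_zero_iff_norm.mpr (hnorm i)⟩, Units.ext ?_⟩
  rw [hd, coe_circleDiagonal]

/-- Circle-torus points commute. [cite: BrockerTomDieck1985, Ch. IV (3.1)] -/
theorem circleDiagonal_mul_comm (z z' : Fin N → Circle) :
    circleDiagonal N z * circleDiagonal N z' = circleDiagonal N z' * circleDiagonal N z := by
  rw [← map_mul, ← map_mul, mul_comm]

end Local

/-! ## §3 `Z_{G_w}(diag z) = T_w` for regular `z` in `G_w = U(σ_w diag α)(ℂ)` -/

section Place

variable (L : Type) [Field L] [NumberField L] [IsCMField L] (N : ℕ) (α : Fin N → L) (w : {w : InfinitePlace L // IsComplex w})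

omit [NumberField L] [IsCMField L] in
/-- **`g ∈ U(σ_w diag α)(ℂ)` CENTRALISES A REGULAR TORUS POINT `diag(z)` (`z` injective) IFF `g` IS A TORUS POINT** (`α` non-degenerate): `⇒` by §1 (`z_i − z_j ≠ 0`) the
matrix of `g` is diagonal, then §2; `⇐` diagonal matrices commute.  Regularity `Injective z` = ★ `isRegularElt_archDiagTorus_iff` ∕ `archWeylDiscr ≠ 0`.
[cite: Rogawski1990, §3.1 p. 19; §8.2 p. 122] [cite: BrockerTomDieck1985, Ch. IV (3.1)] -/
theorem mem_centralizer_circleDiagonal_iff (hα : ∀ i, α i ≠ 0) {z : Fin N → Circle} (hz : Function.Injective z)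
    (g : archLocal L N (Matrix.diagonal α) w) :
    g ∈ Subgroup.centralizer
        ({⟨circleDiagonal N z, circleDiagonal_mem_archLocal_diagonal L N α w z⟩} : Set (archLocal L N (Matrix.diagonal α) w)) ↔
      (g : GL (Fin N) ℂ) ∈ (circleDiagonal N).range := by
  rw [Subgroup.mem_centralizer_singleton_iff]
  constructor
  · intro hcomm
    -- the matrices commute
    have hmat : Matrix.diagonal (fun i => (z i : ℂ)) * ((g : GL (Fin N) ℂ) : Matrix (Fin N) (Fin N) ℂ) =
        ((g : GL (Fin N) ℂ) : Matrix (Fin N) (Fin N) ℂ) * Matrix.diagonal fun i => (z i : ℂ) := by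
      have h1 := congrArg (fun x : archLocal L N (Matrix.diagonal α) w => ((x : GL (Fin N) ℂ) : Matrix (Fin N) (Fin N) ℂ)) hcomm.symm
      simpa only [Subgroup.coe_mul, Units.val_mul, coe_circleDiagonal] using h1
    -- regular: `z_i − z_j ≠ 0` for `i ≠ j`
    have hd : ∀ i j : Fin N, i ≠ j → IsUnit ((z i : ℂ) - z j) := fun i j hij =>
      isUnit_iff_ne_zero.mpr (sub_ne_zero.mpr fun h => hij (hz (Circle.coe_injective h)))
    have hdiag := eq_diagonal_of_diagonal_mul_eq_mul_diagonal hd hmat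
    -- the form at `w`: `σ_w (diag α) = diag (σ_w α)`, non-degenerate
    have hmem : (g : GL (Fin N) ℂ) ∈ unitaryGroupOfForm (starRingEnd ℂ) (Matrix.diagonal fun i => w.1.embedding (α i)) := by
      have h := g.2
      rw [mem_archLocal_iff, Matrix.diagonal_map (map_zero _)] at h
      exact h
    have he : ∀ i, w.1.embedding (α i) ≠ 0 := fun i => (_root_.map_ne_zero _).mpr (hα i)
    obtain ⟨z', hz'⟩ := exists_eq_circleDiagonal_of_coe_eq_diagonal N he hmem hdiag
    exact ⟨z', hz'.symm⟩
  · rintro ⟨z', hz'⟩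
    apply Subtype.ext
    change (g : GL (Fin N) ℂ) * circleDiagonal N z = circleDiagonal N z * (g : GL (Fin N) ℂ)
    rw [← hz', circleDiagonal_mul_comm]

omit [NumberField L] [IsCMField L] in
/-- **`Z_{G_w}(diag z) = T_w`**: for a regular torus point (`z` injective) the centraliser in `G_w = U(σ_w diag α)(ℂ)` is the circle torus `T_w = range (circleDiagonal N)`
(viewed inside `G_w` via `Subgroup.subgroupOf`). [cite: Rogawski1990, §3.1 p. 19; §8.2 p. 122] [cite: BrockerTomDieck1985, Ch. IV (3.1)] -/
theorem centralizer_circleDiagonal_eq_subgroupOf (hα : ∀ i, α i ≠ 0) {z : Fin N → Circle} (hz : Function.Injective z) :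
    Subgroup.centralizer
        ({⟨circleDiagonal N z, circleDiagonal_mem_archLocal_diagonal L N α w z⟩} : Set (archLocal L N (Matrix.diagonal α) w)) =
      (circleDiagonal N).range.subgroupOf (archLocal L N (Matrix.diagonal α) w) := by
  ext g
  rw [mem_centralizer_circleDiagonal_iff L N α w hα hz, Subgroup.mem_subgroupOf]

omit [NumberField L] [IsCMField L] in
/-- The torus `T_w` inside `G_w` is commutative (elementwise form; no instance declared). [cite: BrockerTomDieck1985, Ch. IV (3.1)] -/
theorem mul_comm_of_mem_range_circleDiagonal {s t : archLocal L N (Matrix.diagonal α) w}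
    (hs : (s : GL (Fin N) ℂ) ∈ (circleDiagonal N).range) (ht : (t : GL (Fin N) ℂ) ∈ (circleDiagonal N).range) : s * t = t * s := by
  obtain ⟨z, hz⟩ := hs
  obtain ⟨z', hz'⟩ := ht
  apply Subtype.ext
  change (s : GL (Fin N) ℂ) * (t : GL (Fin N) ℂ) = (t : GL (Fin N) ℂ) * (s : GL (Fin N) ℂ)
  rw [← hz, ← hz', circleDiagonal_mul_comm]

omit [NumberField L] [IsCMField L] in
/-- At a regular torus point the centraliser is COMMUTATIVE (so every Haar measure on it is two-sided and inversion invariant — the input of ★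
`OrbitalMeasureFamily.exists_isQuotientOf` ∕ ★ `isMulRightInvariant_of_isHaarMeasure_centralizer_arch`). [cite: Rogawski1990, §3.1 p. 19] -/
theorem centralizer_circleDiagonal_mul_comm (hα : ∀ i, α i ≠ 0) {z : Fin N → Circle} (hz : Function.Injective z)
    (s t : Subgroup.centralizer
        ({⟨circleDiagonal N z, circleDiagonal_mem_archLocal_diagonal L N α w z⟩} : Set (archLocal L N (Matrix.diagonal α) w))) :
    s * t = t * s := by
  have hs : ((s : archLocal L N (Matrix.diagonal α) w) : GL (Fin N) ℂ) ∈ (circleDiagonal N).range :=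
    (mem_centralizer_circleDiagonal_iff L N α w hα hz _).mp s.2
  have ht : ((t : archLocal L N (Matrix.diagonal α) w) : GL (Fin N) ℂ) ∈ (circleDiagonal N).range :=
    (mem_centralizer_circleDiagonal_iff L N α w hα hz _).mp t.2
  exact Subtype.ext (mul_comm_of_mem_range_circleDiagonal L N α w hs ht)

end Place

end UnitaryGroup

end Literature.NumberTheory.Automorphic

end


/-! ## §4 (ED. 2, «D2′a» (V9) block form) Centralisers of ARBITRARY torus points: block matrices along the eigenvalue partition

For a possibly SINGULAR torus point `γ_z = diag(z)` (repeated `z_i` allowed) an element `g` of `G_w = U(σ_w diag α)(ℂ)` — indeed any matrix — commutes with `diag(z)`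
iff its entries vanish across distinct eigenvalues: `g_{ij} = 0` whenever `z_i ≠ z_j`.  At a split-singular `γ₀ = diag(a, a, b)` of `U(2,1)` this says
`Z(γ₀) = G_w ∩ (2+1 block matrices)` = the `U(σ_w diag(α₁,α₂)) × U(σ_w α₃)` of print ([Rogawski1990] §8.2 p. 122: «the centralizer of `γ₀` is `H`»; the compact
inner form `H′` at `γ₀′`) — CENSUS-D2prime-HClimit §4 (V9) in block form (the group isomorphism with the `2×2` unitary group is left to the descent brick). -/

noncomputable section

namespace Literature.LinearAlgebra.Matrix

variable {R : Type*} [CommRing R] {n : Type*} [Fintype n] [DecidableEq n]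

/-- **Block criterion** (any commutative ring, `d_i − d_j` a unit OR zero for all `i, j` — e.g. over a field): `diag(d)·A = A·diag(d)` iff `A_{ij} = 0` whenever
`d_i ≠ d_j`. [cite: BrockerTomDieck1985, Ch. IV (3.1)] [cite: Rogawski1990, §3.8 p. 38] -/
theorem diagonal_mul_eq_mul_diagonal_iff_apply_eq_zero {d : n → R} (hd : ∀ i j, d i ≠ d j → IsUnit (d i - d j)) (A : Matrix n n R) :
    Matrix.diagonal d * A = A * Matrix.diagonal d ↔ ∀ i j, d i ≠ d j → A i j = 0 := by
  constructor
  · intro h i j hij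
    exact apply_eq_zero_of_diagonal_mul_eq_mul_diagonal h (hd i j hij)
  · intro h
    ext i j
    rw [Matrix.diagonal_mul, Matrix.mul_diagonal]
    by_cases hij : d i = d j
    · rw [hij, mul_comm]
    · rw [h i j hij, mul_zero, zero_mul]

end Literature.LinearAlgebra.Matrix

namespace Literature.NumberTheory.Automorphic

namespace UnitaryGroup

open Literature.LinearAlgebra.Matrix

variable (L : Type) [Field L] (N : ℕ) (α : Fin N → L) (w : {w : NumberField.InfinitePlace L // NumberField.InfinitePlace.IsComplex w})

/-- **CENTRALISER OF AN ARBITRARY TORUS POINT, BLOCK FORM**: `g ∈ U(σ_w diag α)(ℂ)` centralises `γ_z = diag(z)` (ANY `z`, repeated values allowed) iff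
`g_{ij} = 0` whenever `z_i ≠ z_j` — `Z(γ_z) = G_w ∩ {block matrices along the partition of z}`; for injective `z` this is §3's torus, for `z = (a, a, b)` in `U(2,1)`
it is print's `H = U(1,1) × U(1)` (or the compact `U(2) × U(1)`) as a BLOCK subgroup. [cite: Rogawski1990, §3.8 p. 38; §8.2 p. 122] [cite: BrockerTomDieck1985, Ch. IV (3.1)] -/
theorem mem_centralizer_circleDiagonal_iff_apply_eq_zero (z : Fin N → Circle) (g : archLocal L N (Matrix.diagonal α) w) :
    g ∈ Subgroup.centralizer
        ({⟨circleDiagonal N z, circleDiagonal_mem_archLocal_diagonal L N α w z⟩} : Set (archLocal L N (Matrix.diagonal α) w)) ↔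
      ∀ i j, z i ≠ z j → ((g : GL (Fin N) ℂ) : Matrix (Fin N) (Fin N) ℂ) i j = 0 := by
  rw [Subgroup.mem_centralizer_singleton_iff]
  have hd : ∀ i j : Fin N, (z i : ℂ) ≠ z j → IsUnit ((z i : ℂ) - z j) := fun i j hij => isUnit_iff_ne_zero.mpr (sub_ne_zero.mpr hij)
  have key := diagonal_mul_eq_mul_diagonal_iff_apply_eq_zero hd ((g : GL (Fin N) ℂ) : Matrix (Fin N) (Fin N) ℂ)
  constructor
  · intro hcomm i j hij
    have hmat : Matrix.diagonal (fun i => (z i : ℂ)) * ((g : GL (Fin N) ℂ) : Matrix (Fin N) (Fin N) ℂ) =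
        ((g : GL (Fin N) ℂ) : Matrix (Fin N) (Fin N) ℂ) * Matrix.diagonal fun i => (z i : ℂ) := by
      have h1 := congrArg (fun x : archLocal L N (Matrix.diagonal α) w => ((x : GL (Fin N) ℂ) : Matrix (Fin N) (Fin N) ℂ)) hcomm.symm
      simpa only [Subgroup.coe_mul, Units.val_mul, coe_circleDiagonal] using h1
    exact key.mp hmat i j fun h => hij (Circle.coe_injective h)
  · intro h
    have hmat := key.mpr fun i j hij => h i j fun h' => hij (congrArg (fun x : Circle => (x : ℂ)) h')
    apply Subtype.ext
    apply Units.ext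
    change ((g : GL (Fin N) ℂ) : Matrix (Fin N) (Fin N) ℂ) * ((circleDiagonal N z : GL (Fin N) ℂ) : Matrix (Fin N) (Fin N) ℂ) =
      ((circleDiagonal N z : GL (Fin N) ℂ) : Matrix (Fin N) (Fin N) ℂ) * ((g : GL (Fin N) ℂ) : Matrix (Fin N) (Fin N) ℂ)
    rw [coe_circleDiagonal, hmat]

end UnitaryGroup

end Literature.NumberTheory.Automorphic

end
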